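import Summits.BirchSwinnertonDyer.BirchSwinnertonDyer.Theorems.ResidualThetaTransportAtTwoRlfTwistedSurjEngine
import HarnessLib

/-!
# T-42 in the kernel, LXXXIII — road (S-C′), brick B3 (i): the TWISTED `𝒫`-currency SurjEngine run for an ARBITRARY
# `Γ`-stable subgroup `S ≤ H¹(K_Σ/K_∞, E[p^∞])` — «every family of local classes at `S₀` is `(loc_v conj_{γⁿ} c)` for one `c ∈ S`»
# from the twisted Cassels input (the `u·conj_γ`-fixed families are hit) and the twisted coinvariant input (`ψ_u(S) = S`)

Cell `bsd-2adic` (run/shared/lean/pub/bsd-2adic/), seat `bsd-2adic-t42` GEN 33 (pen RC-521 (3) / RC-528 SUMMON «B3/B4», memo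
`t42/DESIGN-T42-ADDENDUM-36.md` §A36.3/§A36.5). HONEST FRAMING: research route; THEOREMS ONLY (no `def`, no named fact, no instance, no
`sorry`); nothing booked; no door or class file is touched; BSD is not proved by any of this. PARTITION: X5@2 multiplicative
GV-transport rows (K4ᵐ B1·O1; the PRINT binder F1 = `Matsuno2008.cor23_lemma24_nonPrimitive_invariants_two`) × p = 2 —
reduces-the-named-input-of; bears_on K4 items 19922 / 19923 (`--supports stmt-BirchSwinnertonDyer-19923`).

## What

The `ResidualThetaTransportAtTwo` lane proved the twisted engine run for the SIGNED non-primitive group `Sel♯_{S₀}`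
(`SignedEC.TwistedSurj.sharp_localRes_surjective_of_twistedCassels_of_twistedCoinv`, seat `prover-bsd-wall-tp2-p2x` g12, p652574): the
abstract criterion `SignedEC.SurjEngine.le_of_fixed_le_of_le_sub_image_of_torsion` run with the twisted shift `T = u·τ` on the
`g`-quasi-periodic torsion families of local classes. Its proof never uses the shape of `Sel♯_{S₀}` — only that it is a subgroup of
`H¹(K_Σ/K_∞, E[p^∞])` whose classes are `p`-power torsion. THIS FILE states the same run for an ARBITRARY subgroup `S` (proof body =
the RTT file's, with `Sel♯_{S₀}` replaced by `S`; credited there), so that the classical NON-PRIMITIVE Selmer group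
`Sel^{Σ₀}_{p^∞}(E/K_∞) = GreenbergVatsal2000.nonPrimitiveSelmerInfty W κ S₀` of the T-42 transport can be fed (sequel LXXXV):

* **`localRes_surjective_of_twistedCassels_of_twistedCoinv`** — `K` a number field, `p` prime, `κ` a `ℤ_p`-extension with
  `H = Gal(K̄/K_∞)`, `γ ∈ Γ_K`, `S₀` finite, `u ≡ 1 (mod p)`, `S ≤ H¹(H, E[p^∞])` any subgroup; local data `N_v = p^{s_v}`, `g_v ∈ Γ_{K_v}`
  with `γ^{N_v} ∈ H·g_v|` (`hg`) and every `p`-power-torsion class of `𝒫_v = H¹(Gal(K̄_v/(K_∞)_η), E(K̄_v))` fixed by some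
  `conj_{g_v^{p^j}}` (`hgper`). ASSUME (TCAS): every family of `p`-power-torsion twisted eigenvectors `z_v ∈ 𝒫_v`
  (`u^{N_v}·conj_{g_v} z_v = z_v`, `v ∈ S₀`) is `(loc_v c)` for a `c ∈ S` with `u·conj_γ c = c`; (TCOINV): every `s ∈ S` is
  `u·conj_γ s′ − s′` with `s′ ∈ S`. THEN every family `(y_{v,n})_{v ∈ S₀, n < N_v}` of `p`-power-torsion classes of `𝒫_v` is
  `(loc_v(conj_{γⁿ} c))` for ONE `c ∈ S`.

In the sequel: `S = Sel^{Σ₀}`, (TCAS) := LXXX/LXXXII `exists_mem_nonPrimitiveSelmerInfty_localResOver_eq_{mult,ord}` (GV Prop. (2.1)'s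
«fixed families are hit», level `ℚ`, twisted, unobstructed models) + the twisted local `Γ`-descent at `v ∤ 2`; (TCOINV) := generic
vanishing of the twisted coinvariants of `Sel^{Σ₀}` from «`X^{Σ₀}` has no finite submodule» (`hF3`) — LXXXIV.

References: [GreenbergLNM1716] §4 Lemma 4.6 and Remark pp. 105–108, Prop. 4.13 and Remark pp. 122–123, Prop. 4.14 pp. 123–124;
[GreenbergVatsal2000] §2 Prop. (2.1), p. 23; [Washington1997] §13.2.
-/

set_option autoImplicit false
set_option linter.dupNamespace false

noncomputable section

open scoped Classical NumberField

open NumberField IsDedekindDomain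

namespace Summit.BirchSwinnertonDyer.BirchSwinnertonDyer.Theorems.MultTransportTwistedDescent

open Literature.NumberTheory.EllipticCurves Literature.NumberTheory.GaloisRepresentations
  WeierstrassCurve ZpExtension
  Summit.BirchSwinnertonDyer.BirchSwinnertonDyer.Theorems.SignedEC
  Summit.BirchSwinnertonDyer.BirchSwinnertonDyer.Theorems.SignedEC.TwistedSurj

universe u

variable {K : Type u} [Field K] [NumberField K] (W : WeierstrassCurve K) {p : ℕ} [Fact p.Prime]

set_option maxHeartbeats 400000 in
/-- **SURJ in the `𝒫`-currency for an arbitrary subgroup `S ≤ H¹(K_Σ/K_∞, E[p^∞])` from the twisted inputs** (Greenberg's Lemma 4.6 /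
Prop. 4.14 road). `K` a number field, `p` a prime, `κ` a `ℤ_p`-extension of `K` with `H = Gal(K̄/K_∞)`, `γ ∈ Γ_K`, `S₀` a finite set of
places, `u ∈ ℤ` with `p ∣ u − 1`, `S` any subgroup of `H¹(H, E[p^∞])`; local data: `N_v = p^{s_v}`, `g_v ∈ Γ_{K_v}` with
`γ^{N_v} ∈ H·g_v|_{K̄}` (`hg`), and every `p`-power-torsion class of `𝒫_v = H¹(Gal(K̄_v/(K_∞)_η), E(K̄_v))` fixed by some `conj_{g_v^{p^j}}`
(`hgper`). ASSUME (TCAS): every family of `p`-power-torsion twisted eigenvectors `z_v ∈ 𝒫_v` (`u^{N_v}·conj_{g_v} z_v = z_v`, `v ∈ S₀`)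
is `(loc_v c)` for some `c ∈ S` with `u·conj_γ c = c`; and (TCOINV): every `s ∈ S` is `u·conj_γ s′ − s′` with `s′ ∈ S`. THEN every
family `(y_{v,n})_{v ∈ S₀, n < N_v}` of `p`-power-torsion classes of `𝒫_v` is `(loc_v(conj_{γⁿ} c))` for one `c ∈ S`. Proof: the
engine `SignedEC.SurjEngine.le_of_fixed_le_of_le_sub_image_of_torsion` with `T := u·(shift)` on the `g`-quasi-periodic torsion families
(body = `SignedEC.TwistedSurj.sharp_localRes_surjective_of_twistedCassels_of_twistedCoinv`, RTT lane, with `Sel♯_{S₀} ↦ S`).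
[cite: GreenbergLNM1716, §4 Lemma 4.6 (p. 107), Prop. 4.13 Remark (p. 123), Prop. 4.14 (pp. 123–124)]
[cite: GreenbergVatsal2000, §2 Prop. (2.1) (p. 23)] -/
theorem localRes_surjective_of_twistedCassels_of_twistedCoinv (κ : ZpExtension K p)
    (γ : Field.absoluteGaloisGroup K) (S : AddSubgroup (W.subgroupH1 p κ.kerSubgroup))
    (S₀ : Finset (HeightOneSpectrum (𝓞 K))) {u : ℤ} (hu : (p : ℤ) ∣ u - 1)
    (N : HeightOneSpectrum (𝓞 K) → ℕ) (hN : ∀ v ∈ S₀, ∃ s : ℕ, N v = p ^ s)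
    (g : ∀ v : HeightOneSpectrum (𝓞 K), Field.absoluteGaloisGroup (v.adicCompletion K))
    (hg : ∀ v ∈ S₀, ∃ h ∈ κ.kerSubgroup, γ ^ N v = h * resGal (K := K) (v.adicCompletion K) (g v))
    (hgper : ∀ v ∈ S₀, ∀ c : discreteH1 (localSubgroup κ.kerSubgroup (v.adicCompletion K)) (localPoints W (v.adicCompletion K)),
      (∃ k : ℕ, p ^ k • c = 0) → ∃ j : ℕ,
        Literature.NumberTheory.EllipticCurves.conjH1 (localSubgroup κ.kerSubgroup (v.adicCompletion K))
          (localPoints W (v.adicCompletion K)) (g v ^ p ^ j) c = c)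
    (htwCas : ∀ z : (∀ v : HeightOneSpectrum (𝓞 K),
        discreteH1 (localSubgroup κ.kerSubgroup (v.adicCompletion K)) (localPoints W (v.adicCompletion K))),
      (∀ v ∈ S₀, ∃ k : ℕ, p ^ k • z v = 0) →
      (∀ v ∈ S₀, u ^ N v • Literature.NumberTheory.EllipticCurves.conjH1 (localSubgroup κ.kerSubgroup (v.adicCompletion K))
          (localPoints W (v.adicCompletion K)) (g v) (z v) = z v) →
      ∃ c ∈ S, u • W.conjH1 p κ.kerSubgroup γ c = c ∧
          ∀ v ∈ S₀, W.localResOver p κ.kerSubgroup (v.adicCompletion K) c = z v)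
    (htwCoinv : ∀ s ∈ S, ∃ s' ∈ S, u • W.conjH1 p κ.kerSubgroup γ s' - s' = s)
    (y : ∀ v : HeightOneSpectrum (𝓞 K), ℕ →
      discreteH1 (localSubgroup κ.kerSubgroup (v.adicCompletion K)) (localPoints W (v.adicCompletion K)))
    (hy : ∀ v ∈ S₀, ∀ n < N v, ∃ k : ℕ, p ^ k • y v n = 0) :
    ∃ c ∈ S, ∀ v ∈ S₀, ∀ n < N v,
        W.localResOver p κ.kerSubgroup (v.adicCompletion K) (W.conjH1 p κ.kerSubgroup (γ ^ n) c) = y v n := by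
  -- the local class groups `𝒫_v`, the local conjugations `Tloc v = conj_{g_v}`
  let P : HeightOneSpectrum (𝓞 K) → Type u := fun v ↦
    discreteH1 (localSubgroup κ.kerSubgroup (v.adicCompletion K)) (localPoints W (v.adicCompletion K))
  let Tloc : ∀ v : HeightOneSpectrum (𝓞 K), P v →+ P v := fun v ↦
    Literature.NumberTheory.EllipticCurves.conjH1 (localSubgroup κ.kerSubgroup (v.adicCompletion K))
      (localPoints W (v.adicCompletion K)) (g v)
  have hTloc_pow : ∀ (v : HeightOneSpectrum (𝓞 K)) (m : ℕ) (c : P v), (Tloc v)^[m] c =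
      Literature.NumberTheory.EllipticCurves.conjH1 (localSubgroup κ.kerSubgroup (v.adicCompletion K))
        (localPoints W (v.adicCompletion K)) (g v ^ m) c := by
    intro v m
    induction m with
    | zero =>
      intro c
      rw [Function.iterate_zero, id, pow_zero, Literature.NumberTheory.EllipticCurves.conjH1_one_holds,
        AddMonoidHom.id_apply]
    | succ m ih =>
      intro c
      rw [Function.iterate_succ_apply', ih, pow_succ',
        Literature.NumberTheory.EllipticCurves.conjH1_mul_holds, AddMonoidHom.comp_apply]
  -- powers of `conj_γ` against the twist: `u·conj_γ c = c ⇒ uⁿ·conj_{γⁿ} c = c`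
  have hconj_pow : ∀ c : W.subgroupH1 p κ.kerSubgroup, u • W.conjH1 p κ.kerSubgroup γ c = c →
      ∀ n : ℕ, u ^ n • W.conjH1 p κ.kerSubgroup (γ ^ n) c = c := by
    intro c hc n
    induction n with
    | zero => rw [pow_zero, one_zsmul, pow_zero, W.conjH1_one_holds p κ.kerSubgroup, AddMonoidHom.id_apply]
    | succ n ih =>
      rw [pow_succ, pow_succ, W.conjH1_mul_holds p κ.kerSubgroup, AddMonoidHom.comp_apply, mul_zsmul,
        ← map_zsmul (W.conjH1 p κ.kerSubgroup (γ ^ n)), hc, ih]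
  -- the ambient group of families, the shift `τ` and the twisted shift `T = u·τ`
  let F : Type u := ∀ v : ↥S₀, ℕ → P v.1
  let τ : F →+ F :=
    { toFun := fun f v n ↦ f v (n + 1)
      map_zero' := rfl
      map_add' := fun _ _ ↦ rfl }
  let T : Module.End ℤ F := u • τ.toIntLinearMap
  have hτ : ∀ (f : F) (v : ↥S₀) (n : ℕ), τ f v n = f v (n + 1) := fun _ _ _ ↦ rfl
  have hT : ∀ (f : F) (v : ↥S₀) (n : ℕ), T f v n = u • f v (n + 1) := fun _ _ _ ↦ rfl
  have hTpow : ∀ (m : ℕ) (f : F) (v : ↥S₀) (n : ℕ), (T ^ m) f v n = u ^ m • f v (n + m) := by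
    intro m
    induction m with
    | zero => intro f v n; rw [pow_zero, Module.End.one_apply, pow_zero, one_zsmul, add_zero]
    | succ m ih =>
      intro f v n
      rw [pow_succ, Module.End.mul_apply, ih, hT, smul_smul, ← pow_succ, add_assoc]
  -- the subgroup `G₀` of `g`-quasi-periodic, uniformly `p`-power-torsion families
  let G₀ : AddSubgroup F :=
    { carrier := {f | (∀ (v : ↥S₀) (n : ℕ), f v (n + N v) = Tloc v (f v n)) ∧ ∃ k : ℕ, ∀ (v : ↥S₀) (n : ℕ), p ^ k • f v n = 0}
      add_mem' := by
        rintro a b ⟨ha1, ka, ha2⟩ ⟨hb1, kb, hb2⟩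
        refine ⟨fun v n ↦ ?_, ka + kb, fun v n ↦ ?_⟩
        · change a v (n + N v) + b v (n + N v) = Tloc v (a v n + b v n)
          rw [map_add, ha1, hb1]
        · change p ^ (ka + kb) • (a v n + b v n) = 0
          rw [smul_add, pow_add, mul_comm, mul_smul, ha2, smul_zero, mul_comm, mul_smul, hb2, smul_zero, add_zero]
      zero_mem' := ⟨fun v n ↦ by change (0 : P v) = Tloc v 0; rw [map_zero], 0, fun v n ↦ smul_zero _⟩
      neg_mem' := by
        rintro a ⟨ha1, ka, ha2⟩
        refine ⟨fun v n ↦ ?_, ka, fun v n ↦ ?_⟩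
        · change -a v (n + N v) = Tloc v (-a v n)
          rw [map_neg, ha1]
        · change p ^ ka • (-a v n) = 0
          rw [smul_neg, ha2, neg_zero] }
  have hG₀ : ∀ f : F, f ∈ G₀ ↔
      (∀ (v : ↥S₀) (n : ℕ), f v (n + N v) = Tloc v (f v n)) ∧ ∃ k : ℕ, ∀ (v : ↥S₀) (n : ℕ), p ^ k • f v n = 0 :=
    fun f ↦ Iff.rfl
  -- quasi-periodicity iterated
  have hqp : ∀ f ∈ G₀, ∀ (v : ↥S₀) (q r : ℕ), f v (r + N v * q) = (Tloc v)^[q] (f v r) := by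
    intro f hf v q
    induction q with
    | zero => intro r; rw [mul_zero, add_zero, Function.iterate_zero, id]
    | succ q ih =>
      intro r
      rw [Nat.mul_succ, ← add_assoc, ((hG₀ f).mp hf).1, ih, Function.iterate_succ_apply']
  -- the detecting map `Φ : c ↦ (loc_v conj_{γⁿ} c)`
  let Φ : W.subgroupH1 p κ.kerSubgroup →+ F :=
    { toFun := fun c v n ↦ W.localResOver p κ.kerSubgroup (v.1.adicCompletion K) (W.conjH1 p κ.kerSubgroup (γ ^ n) c)
      map_zero' := by funext v n; simp only [map_zero]; rfl
      map_add' := fun a b ↦ by funext v n; simp only [map_add]; rfl }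
  have hΦ : ∀ c (v : ↥S₀) n, Φ c v n =
      W.localResOver p κ.kerSubgroup (v.1.adicCompletion K) (W.conjH1 p κ.kerSubgroup (γ ^ n) c) := fun _ _ _ ↦ rfl
  -- `Φ (conj_γ c) = τ (Φ c)`
  have hΦconj : ∀ c, Φ (W.conjH1 p κ.kerSubgroup γ c) = τ (Φ c) := by
    intro c
    funext v n
    change W.localResOver p κ.kerSubgroup (v.1.adicCompletion K)
        (W.conjH1 p κ.kerSubgroup (γ ^ n) (W.conjH1 p κ.kerSubgroup γ c)) =
      W.localResOver p κ.kerSubgroup (v.1.adicCompletion K) (W.conjH1 p κ.kerSubgroup (γ ^ (n + 1)) c)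
    rw [pow_succ, W.conjH1_mul_holds p κ.kerSubgroup, AddMonoidHom.comp_apply]
  -- `Φ c` is quasi-periodic: `conj_{γ^{N_v}} = conj_{h·g_v|}` and localisation is `D_v`-equivariant
  have hΦqp : ∀ c (v : ↥S₀) (n : ℕ), Φ c v (n + N v) = Tloc v (Φ c v n) := by
    intro c v n
    obtain ⟨h, hh, hgv⟩ := hg v.1 v.2
    rw [hΦ, hΦ, pow_add, W.conjH1_mul_holds p κ.kerSubgroup, AddMonoidHom.comp_apply]
    -- `conj_{γⁿ}` and `conj_{γ^N}` commute
    have hcomm : W.conjH1 p κ.kerSubgroup (γ ^ n) (W.conjH1 p κ.kerSubgroup (γ ^ N v) c) =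
        W.conjH1 p κ.kerSubgroup (γ ^ N v) (W.conjH1 p κ.kerSubgroup (γ ^ n) c) := by
      rw [← AddMonoidHom.comp_apply, ← W.conjH1_mul_holds p κ.kerSubgroup, ← pow_add, add_comm, pow_add,
        W.conjH1_mul_holds p κ.kerSubgroup, AddMonoidHom.comp_apply]
    rw [hcomm, hgv, W.conjH1_mul_holds p κ.kerSubgroup, AddMonoidHom.comp_apply, W.conjH1_of_mem_holds p κ.kerSubgroup hh,
      AddMonoidHom.id_apply, WeierstrassCurve.localResOver_conjH1_resGal]
  -- the image `I` of `Sel♯_{S₀}` and `I ≤ G₀`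
  let I : AddSubgroup F := S.map Φ
  have hI : ∀ f : F, f ∈ I ↔ ∃ c ∈ S, Φ c = f := fun f ↦ AddSubgroup.mem_map
  have hIG : I ≤ G₀ := by
    intro f hf
    obtain ⟨c, hc, rfl⟩ := (hI f).mp hf
    refine (hG₀ _).mpr ⟨fun v n ↦ hΦqp c v n, ?_⟩
    obtain ⟨k, hk⟩ := W.exists_pow_smul_subgroupH1_ker_eq_zero κ c
    refine ⟨k, fun v n ↦ ?_⟩
    rw [hΦ, ← map_nsmul, ← map_nsmul, hk, map_zero, map_zero]
  -- `T` preserves `G₀`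
  have hTG : ∀ f ∈ G₀, T f ∈ G₀ := by
    intro f hf
    obtain ⟨h1, k, h2⟩ := (hG₀ f).mp hf
    refine (hG₀ _).mpr ⟨fun v n ↦ ?_, k, fun v n ↦ ?_⟩
    · rw [hT, hT, add_right_comm, h1, map_zsmul]
    · rw [hT, smul_comm, h2 v (n + 1), zsmul_zero]
  -- every `f ∈ G₀` is fixed by some `T^{p^K}`
  have hper : ∀ f ∈ G₀, ∃ K : ℕ, (T ^ p ^ K) f = f := by
    intro f hf
    obtain ⟨h1, k, h2⟩ := (hG₀ f).mp hf
    -- a uniform exponent `J` with `conj_{g_v^{p^J}}` fixing `f v n`, `n < N v`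
    obtain ⟨J, hJ⟩ := exists_uniform_nat (ι := ↥S₀) (fun v ↦ N v)
      (fun v n j ↦ Literature.NumberTheory.EllipticCurves.conjH1 (localSubgroup κ.kerSubgroup (v.1.adicCompletion K))
        (localPoints W (v.1.adicCompletion K)) (g v ^ p ^ j) (f v n) = f v n)
      (fun v n j j' hjj' hfix ↦ by
        have e : g v.1 ^ p ^ j' = (g v.1 ^ p ^ j) ^ p ^ (j' - j) := by
          rw [← pow_mul, ← pow_add, Nat.add_sub_cancel' hjj']
        rw [e]
        exact conjH1_pow_eq_self _ _ hfix _)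
      (fun v n _ ↦ hgper v.1 v.2 (f v n) ⟨k, h2 v n⟩)
    -- exponents of the `N v`
    have hs : ∀ v : ↥S₀, ∃ s : ℕ, N v = p ^ s := fun v ↦ hN v.1 v.2
    obtain ⟨S, hS'⟩ := exists_uniform_nat (ι := ↥S₀) (fun _ ↦ 1) (fun v _ s ↦ N v ∣ p ^ s)
      (fun v n s s' hss' hd ↦ hd.trans (pow_dvd_pow p hss')) (fun v n _ ↦ by
        obtain ⟨s, hs⟩ := hs v; exact ⟨s, by rw [hs]⟩)
    refine ⟨S + J + k, ?_⟩
    funext v n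
    rw [hTpow]
    obtain ⟨m, hm⟩ := hS' v 0 Nat.one_pos
    have hNpos : 0 < N v := by obtain ⟨s, hs⟩ := hs v; rw [hs]; exact pow_pos (Fact.out : p.Prime).pos s
    -- `f v` has period `N v * p^J`
    have hperiod : ∀ r : ℕ, f v (r + N v * p ^ J) = f v r := by
      intro r
      have hr : r = r % N v + N v * (r / N v) := (Nat.mod_add_div r (N v)).symm
      rw [hr, add_assoc, ← mul_add, hqp f hf, hqp f hf, Function.iterate_add_apply, hTloc_pow v (p ^ J)]
      · congr 1
        exact hJ v (r % N v) (Nat.mod_lt r hNpos)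
    have e : p ^ (S + J + k) = N v * p ^ J * (p ^ S / N v * p ^ k) := by
      rw [pow_add, pow_add, hm, Nat.mul_div_cancel_left _ hNpos]
      ring
    -- iterate the period
    have hmult : ∀ q r : ℕ, f v (r + N v * p ^ J * q) = f v r := by
      intro q
      induction q with
      | zero => intro r; rw [mul_zero, add_zero]
      | succ q ih => intro r; rw [Nat.mul_succ, ← add_assoc, hperiod, ih]
    have hper' : f v (n + p ^ (S + J + k)) = f v n := by rw [e, hmult]
    rw [hper']
    -- the twist `u^{p^{S+J+k}}` fixes the `p^k`-torsion value
    exact pow_pow_zsmul_eq_self_of_pow_nsmul_eq_zero hu (by omega) (h2 v n)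
  -- uniform torsion
  have htor : ∀ f ∈ G₀, ∃ j : ℕ, p ^ j • f = 0 := by
    intro f hf
    obtain ⟨-, k, h2⟩ := (hG₀ f).mp hf
    exact ⟨k, funext fun v ↦ funext fun n ↦ h2 v n⟩
  -- `I_{ψ_u} = 0`: twisted coinvariant vanishing
  have hcoinv : ∀ i ∈ I, ∃ j ∈ I, T j - j = i := by
    intro i hi
    obtain ⟨s, hs, rfl⟩ := (hI i).mp hi
    obtain ⟨s', hs', hss'⟩ := htwCoinv s hs
    refine ⟨Φ s', (hI _).mpr ⟨s', hs', rfl⟩, ?_⟩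
    have e : T (Φ s') = Φ (u • W.conjH1 p κ.kerSubgroup γ s') := by
      rw [map_zsmul, hΦconj]; rfl
    rw [e, ← map_sub, hss']
  -- the `T`-fixed families come from twisted-invariant classes (TCAS♯)
  have hfix : ∀ f ∈ G₀, T f = f → f ∈ I := by
    intro f hf hTf
    obtain ⟨h1, k, h2⟩ := (hG₀ f).mp hf
    -- `uⁿ • f v n = f v 0`
    have hgeom : ∀ (v : ↥S₀) (n : ℕ), u ^ n • f v n = f v 0 := by
      intro v n
      induction n with
      | zero => rw [pow_zero, one_zsmul]
      | succ n ih =>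
        have e := congrArg (fun F' : F ↦ F' v n) hTf
        rw [hT] at e
        rw [pow_succ, mul_zsmul, e, ih]
    -- the value at `0` is a twisted eigenvector of `conj_{g_v}`
    have heig : ∀ v : ↥S₀, u ^ N v • Tloc v (f v 0) = f v 0 := by
      intro v
      have e := h1 v 0
      rw [zero_add] at e
      rw [← e, hgeom v (N v)]
    -- the family of values at `0` (junk off `S₀`)
    have hzdata : ∃ z : ∀ v : HeightOneSpectrum (𝓞 K), P v, ∀ v, z v = if hv : v ∈ S₀ then f ⟨v, hv⟩ 0 else 0 :=
      ⟨_, fun _ ↦ rfl⟩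
    obtain ⟨z, hz⟩ := hzdata
    have hzS : ∀ (v : HeightOneSpectrum (𝓞 K)) (hv : v ∈ S₀), z v = f ⟨v, hv⟩ 0 := fun v hv ↦ by rw [hz v, dif_pos hv]
    obtain ⟨c, hcS, hcu, hcz⟩ := htwCas z (fun v hv ↦ ⟨k, by rw [hzS v hv]; exact h2 ⟨v, hv⟩ 0⟩)
      (fun v hv ↦ by rw [hzS v hv]; exact heig ⟨v, hv⟩)
    refine (hI f).mpr ⟨c, hcS, ?_⟩
    funext v n
    -- `uⁿ • (Φ c v n − f v n) = 0`, both `p`-power torsion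
    obtain ⟨kc, hkc⟩ := W.exists_pow_smul_subgroupH1_ker_eq_zero κ c
    have hΦtor : p ^ kc • Φ c v n = 0 := by
      rw [hΦ, ← map_nsmul, ← map_nsmul, hkc, map_zero, map_zero]
    have hdiff : u ^ n • (Φ c v n - f v n) = 0 := by
      rw [zsmul_sub, hgeom v n, hΦ, ← map_zsmul (W.localResOver p κ.kerSubgroup (v.1.adicCompletion K)),
        hconj_pow c hcu n, hcz v.1 v.2, hzS v.1 v.2, sub_self]
    have htor2 : p ^ (kc + k) • (Φ c v n - f v n) = 0 := by
      rw [smul_sub, pow_add, mul_comm, mul_smul, hΦtor, smul_zero, mul_comm, mul_smul, h2 v n, smul_zero, sub_zero]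
    exact sub_eq_zero.mp (eq_zero_of_pow_zsmul_eq_zero_of_pow_nsmul_eq_zero hu hdiff htor2)
  -- THE ENGINE: `G₀ ≤ I`
  have hGI : G₀ ≤ I :=
    SurjEngine.le_of_fixed_le_of_le_sub_image_of_torsion p T I G₀ hIG hTG hper htor hfix hcoinv
  -- the target family, extended `g`-quasi-periodically
  obtain ⟨k₀, hk₀⟩ := exists_uniform_nat (ι := ↥S₀) (fun v ↦ N v) (fun v n k ↦ p ^ k • y v.1 n = 0)
    (fun v n k k' hkk' hk ↦ by
      rw [← Nat.add_sub_cancel' hkk', pow_add, mul_comm, mul_smul, hk, smul_zero])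
    (fun v n hn ↦ hy v.1 v.2 n hn)
  have hNpos : ∀ v : ↥S₀, 0 < N v := fun v ↦ by
    obtain ⟨s, hs⟩ := hN v.1 v.2; rw [hs]; exact pow_pos (Fact.out : p.Prime).pos s
  have hfdata : ∃ f : F, ∀ v n, f v n = (Tloc v)^[n / N v] (y v.1 (n % N v)) := ⟨_, fun _ _ ↦ rfl⟩
  obtain ⟨f, hf⟩ := hfdata
  have hfG : f ∈ G₀ := by
    refine (hG₀ f).mpr ⟨fun v n ↦ ?_, k₀, fun v n ↦ ?_⟩
    · rw [hf, hf, Nat.add_div_right _ (hNpos v), Nat.add_mod_right, Function.iterate_succ_apply']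
    · rw [hf, hTloc_pow, ← map_nsmul, hk₀ v (n % N v) (Nat.mod_lt _ (hNpos v)), map_zero]
  obtain ⟨c, hc, hcf⟩ := (hI f).mp (hGI hfG)
  refine ⟨c, hc, fun v hv n hn ↦ ?_⟩
  have e := congrArg (fun F' : F ↦ F' ⟨v, hv⟩ n) hcf
  rw [hΦ, hf, Nat.div_eq_of_lt hn, Nat.mod_eq_of_lt hn, Function.iterate_zero, id] at e
  exact e


end Summit.BirchSwinnertonDyer.BirchSwinnertonDyer.Theorems.MultTransportTwistedDescent

end
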